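import Summits.Ventures.PercRepro0.AllOpen
import Mathlib.MeasureTheory.Constructions.UnitInterval

/-!
# L1 · MONOTONE on `Defs.lean` (the uniform coupling) and the unconditional L2 twin

Cell pub-perc-repro0, seat p2.  The standard coupling of GLUE-p2-v2 L1 on the cell's definitions:
i.i.d. uniform labels `u e ∈ [0,1]` on the bonds, the bond `e` being open at level `p` iff `e ∈ 𝔼^d` and
`u e ≤ p` (`thresholdCfg`).  The law of the thresholded configuration is `P_p` (`map_thresholdCfg`:
`setBernoulli` is the image of an infinite product, and the threshold map is a coordinatewise map of
infinite products, `Measure.infinitePi_map_pi`).  Consequences: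

* `L1_Monotone_holds : Defs.L1_Monotone d` — `P_p(A) ≤ P_q(A)` for `p ≤ q` and measurable upper sets `A`;
* `thetaI_mono : Monotone (thetaI d)`;
* `L2_RightCont_holds : Defs.L2_RightCont d` — the Lean twin of L2, now unconditional;
* `theta_mono`, `theta_eq_zero_of_lt_pc`, `theta_pos_of_pc_lt`, `thetaI_zero`, `pc_eq_sSup_zeroSet'` — L0 · PC-FORMS
  on `Defs`, unconditional for `d ≥ 1`.

(p5 has an independent coupling proof, STATUS 23:01:11Z; this file makes the L-block twin self-contained.)
-/

open MeasureTheory ProbabilityTheory unitInterval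
open scoped ENNReal Topology

namespace Summit.Ventures.PercRepro0.L2

open Summit.Ventures.PercRepro0.Defs

variable {d : ℕ}

-- BEGIN BODY

/-! ### The coupling -/

/-- Independent uniform labels on the bonds. -/
noncomputable def uniformProd (d : ℕ) : Measure (Sym2 (Vertex d) → I) :=
  Measure.infinitePi fun _ : Sym2 (Vertex d) => (volume : Measure I)

/-- `uniformProd d` is a probability measure. -/
instance : IsProbabilityMeasure (uniformProd d) := by
  unfold uniformProd; infer_instance

/-- The one-bond threshold predicate: `e` is open iff it is a bond and its label is `≤ p`. -/
def thrProp (p : I) (e : Sym2 (Vertex d)) (t : I) : Prop := e ∈ bonds d ∧ t ≤ p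

/-- The thresholded configuration at level `p`. -/
def thresholdCfg (p : I) (u : Sym2 (Vertex d) → I) : Config d := {e | thrProp p e (u e)}

/-- `thrProp p e` is measurable. -/
lemma measurable_thrProp (p : I) (e : Sym2 (Vertex d)) : Measurable (thrProp p e) := by
  refine measurable_to_countable' fun q => ?_
  rcases Classical.em q with hq | hq
  · rw [eq_true hq]
    by_cases he : e ∈ bonds d
    · have : thrProp p e ⁻¹' {True} = Set.Iic p := by
        ext t; simp [thrProp, he]
      rw [this]; exact measurableSet_Iic
    · have : thrProp p e ⁻¹' {True} = ∅ := by
        ext t; simp [thrProp, he]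
      rw [this]; exact MeasurableSet.empty
  · rw [eq_false hq]
    by_cases he : e ∈ bonds d
    · have : thrProp p e ⁻¹' {False} = Set.Ioi p := by
        ext t; simp [thrProp, he]
      rw [this]; exact measurableSet_Ioi
    · have : thrProp p e ⁻¹' {False} = Set.univ := by
        ext t; simp [thrProp, he]
      rw [this]; exact MeasurableSet.univ

/-- The threshold map is measurable. -/
lemma measurable_thresholdCfg (p : I) : Measurable (thresholdCfg (d := d) p) :=
  measurable_set_iff.2 fun e => (measurable_thrProp p e).comp (measurable_pi_apply e)

/-- `ENNReal.ofReal p = ↑(toNNReal p)` for `p ∈ [0,1]`. -/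
lemma ofReal_eq_toNNReal (p : I) :
    ENNReal.ofReal (p : ℝ) = ((unitInterval.toNNReal p : NNReal) : ℝ≥0∞) := by
  rw [ENNReal.ofReal]
  congr 1
  ext
  simp [Real.toNNReal_of_nonneg p.2.1]

/-- The law of one thresholded label is the one-bond factor of `setBernoulli`. -/
lemma map_thrProp (p : I) (e : Sym2 (Vertex d)) :
    (volume : Measure I).map (thrProp p e) =
      toNNReal p • Measure.dirac (e ∈ bonds d) + toNNReal (σ p) • Measure.dirac False := by
  refine Measure.ext_of_singleton fun q => ?_
  rw [Measure.map_apply (measurable_thrProp p e) (measurableSet_singleton q)]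
  simp only [Measure.add_apply, Measure.smul_apply, Measure.dirac_apply]
  rcases Classical.em q with hq | hq
  · rw [eq_true hq]
    by_cases he : e ∈ bonds d
    · have h1 : thrProp p e ⁻¹' {True} = Set.Iic p := by ext t; simp [thrProp, he]
      have h2 : (e ∈ bonds d) ∈ ({True} : Set Prop) := by simp [he]
      have h3 : False ∉ ({True} : Set Prop) := by simp
      rw [h1, unitInterval.volume_Iic, Set.indicator_of_mem h2, Set.indicator_of_notMem h3,
        ofReal_eq_toNNReal]
      simp
    · have h1 : thrProp p e ⁻¹' {True} = ∅ := by ext t; simp [thrProp, he]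
      have h2 : (e ∈ bonds d) ∉ ({True} : Set Prop) := by simp [he]
      have h3 : False ∉ ({True} : Set Prop) := by simp
      rw [h1, Set.indicator_of_notMem h2, Set.indicator_of_notMem h3]
      simp
  · rw [eq_false hq]
    by_cases he : e ∈ bonds d
    · have h1 : thrProp p e ⁻¹' {False} = Set.Ioi p := by ext t; simp [thrProp, he]
      have h2 : (e ∈ bonds d) ∉ ({False} : Set Prop) := by simp [he]
      have h3 : False ∈ ({False} : Set Prop) := by simp
      rw [h1, unitInterval.volume_Ioi, Set.indicator_of_notMem h2, Set.indicator_of_mem h3,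
        ← unitInterval.coe_symm_eq, ofReal_eq_toNNReal]
      simp
    · have h1 : thrProp p e ⁻¹' {False} = Set.univ := by ext t; simp [thrProp, he]
      have h2 : (e ∈ bonds d) ∈ ({False} : Set Prop) := by simp [he]
      have h3 : False ∈ ({False} : Set Prop) := by simp
      rw [h1, measure_univ, Set.indicator_of_mem h2, Set.indicator_of_mem h3]
      simp only [Pi.one_apply, ENNReal.smul_def, smul_eq_mul, mul_one]
      rw [← ENNReal.coe_add]
      have : unitInterval.toNNReal p + unitInterval.toNNReal (σ p) = 1 := by
        ext; simp
      rw [this, ENNReal.coe_one]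

/-- The standard coupling: the thresholded uniform labels have law `P_p`. -/
lemma map_thresholdCfg (p : I) : (uniformProd d).map (thresholdCfg p) = P d p := by
  unfold P
  rw [setBernoulli_eq_map]
  have hm : Measurable (fun (u : Sym2 (Vertex d) → I) (e : Sym2 (Vertex d)) => thrProp p e (u e)) :=
    measurable_pi_lambda _ fun e => (measurable_thrProp p e).comp (measurable_pi_apply e)
  have hcomp : thresholdCfg (d := d) p =
      (fun q : Sym2 (Vertex d) → Prop => {i | q i}) ∘
        (fun (u : Sym2 (Vertex d) → I) (e : Sym2 (Vertex d)) => thrProp p e (u e)) := by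
    funext u; rfl
  rw [hcomp, ← Measure.map_map measurable_setOf hm]
  unfold uniformProd
  rw [Measure.infinitePi_map_pi _ fun e => measurable_thrProp p e]
  have hf : (fun e : Sym2 (Vertex d) => (volume : Measure I).map (thrProp p e)) =
      fun e => toNNReal p • Measure.dirac (e ∈ bonds d) + toNNReal (σ p) • Measure.dirac False :=
    funext fun e => map_thrProp p e
  rw [hf]

/-- Thresholds are monotone in the level. -/
lemma thresholdCfg_mono {p q : I} (hpq : p ≤ q) (u : Sym2 (Vertex d) → I) :
    thresholdCfg p u ⊆ thresholdCfg q u :=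
  fun _ he => ⟨he.1, he.2.trans hpq⟩

/-! ### L1 and the unconditional L2 -/

/-- L1 (general form): `P_p(A) ≤ P_q(A)` for `p ≤ q` and measurable upper sets `A`. -/
theorem P_mono_of_isUpperSet {A : Set (Config d)} (hA : IsUpperSet A) (hm : MeasurableSet A)
    {p q : I} (hpq : p ≤ q) : P d p A ≤ P d q A := by
  rw [← map_thresholdCfg p, ← map_thresholdCfg q, Measure.map_apply (measurable_thresholdCfg p) hm,
    Measure.map_apply (measurable_thresholdCfg q) hm]
  exact measure_mono fun u hu => hA (thresholdCfg_mono hpq u) hu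

/-- Lean twin of `Defs.L1_Monotone d`. -/
theorem L1_Monotone_holds : L1_Monotone d :=
  fun _ _ hpq _ hA hm => P_mono_of_isUpperSet hA hm hpq

/-- Opening more bonds only creates connections. -/
lemma conn_mono_of_subset {ω ω' : Config d} (h : ω ⊆ ω') {x y : Vertex d} (hc : Conn d ω x y) :
    Conn d ω' x y :=
  hc.mono (SimpleGraph.fromEdgeSet_mono (Set.inter_subset_inter_left _ h))

/-- `{0 ↔ ∞}` is an upper set. -/
lemma isUpperSet_percolates : IsUpperSet (percolates d) :=
  fun _ _ h hω => (hω : (cluster d _ 0).Infinite).mono fun _ hy => conn_mono_of_subset h hy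

/-- L1: `θ_d` is nondecreasing on `[0,1]`. -/
theorem thetaI_mono (d : ℕ) : Monotone (thetaI d) := fun _ _ hpq =>
  ENNReal.toReal_mono (measure_ne_top _ _)
    (P_mono_of_isUpperSet isUpperSet_percolates measurableSet_percolates hpq)

/-- L2 · RIGHT-CONT, unconditional Lean twin of `Defs.L2_RightCont d`. -/
theorem L2_RightCont_holds (d : ℕ) : L2_RightCont d := L2_RightCont_of_mono (thetaI_mono d)

/-! ### L0 · PC-FORMS on `Defs` (unconditional) -/

/-- `θ_d` is nondecreasing on `ℝ` (clamped). -/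
theorem theta_mono (d : ℕ) : Monotone (theta d) := fun _ _ hpq =>
  thetaI_mono d (Set.monotone_projIcc _ hpq)

/-- `θ_d = 0` on `[0, p_c(d))`. -/
theorem theta_eq_zero_of_lt_pc {p : ℝ} (hp0 : 0 ≤ p) (hp1 : p ≤ 1) (hp : p < pc d) :
    theta d p = 0 := by
  by_contra h
  have hpos : 0 < theta d p := lt_of_le_of_ne (theta_nonneg d p) (Ne.symm h)
  have : pc d ≤ p := csInf_le ⟨0, fun _ hq => hq.1.1⟩ ⟨⟨hp0, hp1⟩, hpos⟩
  linarith

/-- `θ_d > 0` on `(p_c(d), 1]` (`d ≥ 1`). -/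
theorem theta_pos_of_pc_lt (hne : (pcSet d).Nonempty) {p : ℝ} (hp : pc d < p) : 0 < theta d p := by
  obtain ⟨q, ⟨-, hqpos⟩, hqp⟩ := exists_lt_of_csInf_lt hne hp
  exact lt_of_lt_of_le hqpos (theta_mono d hqp.le)

/-- L0 · PC-FORMS: `p_c(d) = sup {p ∈ [0,1] : θ_d(p) = 0}` (`d ≥ 1`, given `{p : θ_d(p) > 0}` nonempty,
i.e. `θ_d(1) = 1`). -/
theorem pc_eq_sSup_zeroSet (hne : (pcSet d).Nonempty) (h0 : (0 : ℝ) ∈ zeroSet d) :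
    pc d = sSup (zeroSet d) := by
  have hbdd : BddAbove (zeroSet d) := ⟨1, fun _ hq => hq.1.2⟩
  have hzne : (zeroSet d).Nonempty := ⟨0, h0⟩
  have hpc0 : 0 ≤ pc d := le_csInf hne fun _ hq => hq.1.1
  have hpc1 : pc d ≤ 1 := by
    obtain ⟨q, hq⟩ := hne
    exact (csInf_le ⟨0, fun _ hq => hq.1.1⟩ hq).trans hq.1.2
  apply le_antisymm
  · by_contra hlt
    push Not at hlt
    obtain ⟨r, hr1, hr2⟩ := exists_between hlt
    have h0le : (0 : ℝ) ≤ sSup (zeroSet d) := le_csSup hbdd h0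
    have hr_mem : r ∈ zeroSet d :=
      ⟨⟨h0le.trans hr1.le, hr2.le.trans hpc1⟩,
        theta_eq_zero_of_lt_pc (h0le.trans hr1.le) (hr2.le.trans hpc1) hr2⟩
    have : r ≤ sSup (zeroSet d) := le_csSup hbdd hr_mem
    linarith
  · refine csSup_le hzne fun q hq => ?_
    by_contra hlt
    push Not at hlt
    have := theta_pos_of_pc_lt hne hlt
    rw [hq.2] at this
    exact lt_irrefl _ this

/-- In the all-closed configuration the cluster of the origin is `{0}`. -/
lemma cluster_empty : cluster d (∅ : Config d) 0 = {0} := by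
  ext x
  simp only [cluster, Set.mem_setOf_eq, Conn, openGraph, Set.empty_inter,
    SimpleGraph.fromEdgeSet_empty, SimpleGraph.reachable_bot, Set.mem_singleton_iff]
  exact eq_comm

/-- `θ_d(0) = 0`. -/
theorem thetaI_zero (d : ℕ) : thetaI d 0 = 0 := by
  unfold thetaI P
  rw [setBernoulli_zero, Measure.dirac_apply' _ measurableSet_percolates, Set.indicator_of_notMem]
  · simp
  · show ¬ (cluster d (∅ : Config d) 0).Infinite
    rw [cluster_empty]
    exact Set.not_infinite.2 (Set.finite_singleton 0)

/-- `0 ∈ zeroSet d`. -/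
lemma zero_mem_zeroSet (d : ℕ) : (0 : ℝ) ∈ zeroSet d := by
  refine ⟨⟨le_rfl, zero_le_one⟩, ?_⟩
  unfold theta
  have hclamp : clamp (0 : ℝ) = (0 : I) := by
    ext; simp [clamp]
  rw [hclamp, thetaI_zero]

/-- L0 · PC-FORMS, unconditional for `d ≥ 1`: `p_c(d) = sup {p ∈ [0,1] : θ_d(p) = 0}`. -/
theorem pc_eq_sSup_zeroSet' (hd : 1 ≤ d) : pc d = sSup (zeroSet d) :=
  pc_eq_sSup_zeroSet (pcSet_nonempty hd) (zero_mem_zeroSet d)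

-- END BODY

end Summit.Ventures.PercRepro0.L2
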